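import Summits.QuantumFields.BalabanUV.Beta.TameKernelCalculus
import Summits.QuantumFields.BalabanUV.Beta.D1BFx.FibredPeriodisation

/-!
# `BalabanUV.Beta.D1BFx.PeriodicArrays` — road «BF-x», binder row D1, slot (K), debt X₃(ii) (ROUTE T of `HOME/b2b-balaban-beta-d1-p2/K-ASSEMBLY-SPEC.md`
# v1 §1), brick **TA2 «PERIODIC ARRAYS OF LOCALISED KERNELS»**: the torus background with ONE excited bond lifts to `ℤ^D` as the PERIODIC ARRAY
# `arr s K := Σ_{t ∈ ℤ^D} shiftK (s·t) K` of the localised kernel `K` — jointly `s`-periodic, `s`-uniformly spread, entrywise `→ K`; its an4-periodisation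
# is the DOUBLE image sum; a periodic decaying leg passes through it; two arrays compose to an array

WHY (K-ASSEMBLY-SPEC §1).  ROUTE T applies the PROVED matrix theorem `SliceTransferJetsMixed.mixedVar_sliceTransfer_jets` on each cubic torus to the periodised
objects and passes `T ↗ ℤ⁴` in the trace functionals (brick TA3).  The legs are block-covariant, hence jointly periodic, and periodise by an4's `periodise₂`
(`Beta/EntrywiseVolumeLimit`; fibrewise `FibredPeriodisation`).  A vertex ∕ table `K` bi-localised at ONE bond pair (`BiLoc K p q C δ`) is NOT periodic and `periodise₂ K`
is not the torus vertex (`periodise₂_compKer` needs a jointly periodic right factor); the torus vertex is the periodisation of the ARRAY `arr s K`.  CONTENT: §1 `arr`, `toF` (the `FKer` reading of an `MKer`); §2 joint periodicity (unconditional); §3 for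
`BiLoc K p q C δ`, `δ > 0`, `s ≥ 1`: convergence of the image series, the ENTRYWISE TAIL `|arr s K x y a b − K x y a b| ≤ C·e^{δ|x−p|₁}·imageTail D (δs)`,
`arr s K → K` entrywise; §4 the `s`-UNIFORM SPREAD `Decays (arr s K) (C·Zl D (δ∕2)·e^{(δ∕2)|p−q|₁}) (δ∕2)` ⟹ `Spr`, `Tame`, `Bdd`, and per fibre `Decay₂` ∕
`RowBound` ∕ summable rows (the hypotheses of `periodise₂_compKer`, `lemma222_periodic`, `periodiseF_compF`) with `s`-free constants; §5 `periodise₂ s (arr s K)ₐᵦ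
x̄ ȳ = Σ'_t Σ'_n K (x̂ + s·t) (ŷ + s·n) a b` and the DIAGONAL UNFOLDING `Σ_{x̄ ∈ T} periodise₂ s (arr s K)ₐᵦ x̄ x̄ = Σ'_{x ∈ ℤ^D} Σ'_m K x (x + s·m) a b` (TA3's
starting line); §6 `comp A (arr s V) = arr s (comp A V)`, `comp (arr s V) A = arr s (comp V A)` (periodic decaying `A`), `comp (arr s X) (arr s Y) = arr s (comp X (arr s Y))`.

HONEST FRAMING (cell contract, verbatim): «discharging `BetaPertH` makes Bałaban's UV stability UNCONDITIONAL — a real constructive-QFT result; it is NOT the continuum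
limit and NOT the Clay problem.»  HONEST DEPENDENCY (verbatim): «continuum YM on T⁴ ⇐ BetaPertH ∧ nine spine estimates (0/9 proved); BetaPertH ⇐ (D1) ∧ (D4) ∧ CAP+tail;
G-an2-4 gates asym, D1 and NE2/3/4.»  [folklore] kernel bookkeeping about the cell's own typed objects; no `Prop` minted, nothing cited, no wall binder instantiated; 0 sorry;
discharges NOTHING of (K), D1 or `BetaPertH`; NOT continuum, NOT Clay.  ABSOLUTE RULE (cell, verbatim): «No internally-minted statement may enter as a cited fact. Every
hypothesis is either kernel-proved in this package or a verbatim quotation of a PUBLISHED theorem with page reference. The manuscript(s) under audit are NOT citable for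
their own disputed steps — they are the thing under adjudication; programme-internal (2001/route/tribunal) claims are never citable.»  Provenance: G-an2-4 swarm leaf
seat `b2b-balaban-gan24-formalise-leaf-06` (gen 29), cross-lane claim «K-TA2» for road «BF-x», 2026-08-20.
-/

noncomputable section

namespace Summit.QuantumFields.BalabanUV.Beta.D1BFx.PeriodicArrays

open Filter Topology
open scoped BigOperators
open Literature.MathematicalPhysics.QuantumFieldTheory.Balaban1983to89
open Literature.MathematicalPhysics.QuantumFieldTheory.Balaban1983to89.Beta
open B12Sec2to5 (l1 l1_nonneg summable_exp_neg_l1)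
open ExpKernelCalculus (Site MKer Decays BiLoc comp shiftK Zl Zl_pos Zl_nonneg summable_exp_shift summable_exp_shift' tsum_exp_shift
  tsum_exp_shift' l1_sub_triangle l1_sub_symm l1_natSmul)
open KernelWard (Bdd bdd_of_decays)
open Summit.QuantumFields.BalabanUV.Beta.TameKernelCalculus (Spr Tame trK trK_comp decays_trK biLoc_trK)
open Summit.QuantumFields.BalabanUV.Beta.D1BFx.FibredPeriodisation (FKer Kfib)

variable {D : ℕ} {F : Type*}

/-! ## §1 The periodic array of a kernel; the `FKer` reading of an `MKer` -/

/-- [our object] **THE PERIODIC ARRAY** of a kernel for the period `s`: `arr s K x y a b := Σ'_{t ∈ ℤ^D} K (x + s·t) (y + s·t) a b` — all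
`s·ℤ^D`-translates of `K` summed (for a kernel bi-localised at one bond pair: the same excitation repeated periodically). -/
def arr (s : ℕ) (K : MKer D F) : MKer D F := fun x y a b => ∑' t : Site D, K (imageShift s x t) (imageShift s y t) a b

/-- [our object] **THE `FKer` READING** of a matrix-fibred kernel (`FibredPeriodisation`'s index convention `(site, fibre)`), so that `Kfib (toF K) a b`
is the scalar `ℤ^D` kernel of the fibre pair `(a, b)` and `periodiseF s (toF K)` its fibrewise periodisation. -/
def toF (K : MKer D F) : FKer D F F := fun i j => K i.1 j.1 i.2 j.2

/-- [our object] Unfolding of `arr`. -/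
theorem arr_apply (s : ℕ) (K : MKer D F) (x y : Site D) (a b : F) : arr s K x y a b = ∑' t, K (imageShift s x t) (imageShift s y t) a b := rfl

/-- [our object] Unfolding of `toF`. -/
@[simp] theorem toF_apply (K : MKer D F) (x y : Site D) (a b : F) : toF K (x, a) (y, b) = K x y a b := rfl

/-- [our object] The fibre `(a, b)` of `toF K` is `(x, y) ↦ K x y a b`. -/
theorem Kfib_toF (K : MKer D F) (a b : F) : Kfib (toF K) a b = fun x y => K x y a b := rfl

/-- [folklore] `x + s·t` as a translate: `imageShift s x t = x + (s : ℤ) • t`. -/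
theorem imageShift_eq_add_smul (s : ℕ) (x t : Site D) : imageShift s x t = x + (s : ℤ) • t := by
  funext i; simp [imageShift]

/-- [folklore] `arr s K = Σ'_t shiftK (s·t) K` entrywise. -/
theorem arr_eq_tsum_shiftK (s : ℕ) (K : MKer D F) (x y : Site D) (a b : F) :
    arr s K x y a b = ∑' t : Site D, shiftK ((s : ℤ) • t) K x y a b := by
  simp only [arr, shiftK, imageShift_eq_add_smul]

/-- [folklore] `arr` commutes with the kernel transpose `trK`. -/
theorem arr_trK (s : ℕ) (K : MKer D F) : arr s (trK K) = trK (arr s K) := rfl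
/-! ## §2 Joint `s`-periodicity of the array (unconditional) -/

/-- [folklore] **THE ARRAY IS JOINTLY `s`-PERIODIC**: `arr s K (x + s·n) (y + s·n) a b = arr s K x y a b` (re-index the image sum by `t ↦ n + t`). -/
theorem arr_imageShift (s : ℕ) (K : MKer D F) (x y n : Site D) (a b : F) :
    arr s K (imageShift s x n) (imageShift s y n) a b = arr s K x y a b := by
  simp only [arr, imageShift_add]
  exact (Equiv.addLeft n).tsum_eq (fun t => K (imageShift s x t) (imageShift s y t) a b)

/-- [folklore] … in `shiftK` form: `shiftK (s·n) (arr s K) = arr s K`. -/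
theorem shiftK_arr (s : ℕ) (K : MKer D F) (n : Site D) : shiftK ((s : ℤ) • n) (arr s K) = arr s K := by
  funext x y a b; simp only [shiftK, ← imageShift_eq_add_smul, arr_imageShift]

/-- [folklore] … in an4's vocabulary: every fibre of the array is `IsPeriodic₂ s`. -/
theorem isPeriodic₂_arr (s : ℕ) (K : MKer D F) (a b : F) : IsPeriodic₂ s (Kfib (toF (arr s K)) a b) :=
  fun x y n => arr_imageShift s K x y n a b

/-- [folklore] Joint `s`-periodicity in pointwise form from `shiftK`-invariance (the tree's block-covariance currency `∀ t, shiftK (s·t) A = A`; §6's hypothesis). -/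
theorem periodic_of_shiftK {A : MKer D F} {s : ℕ} (h : ∀ t : Site D, shiftK ((s : ℤ) • t) A = A) (x y t : Site D) (a b : F) :
    A (imageShift s x t) (imageShift s y t) a b = A x y a b := by
  simpa only [shiftK, ← imageShift_eq_add_smul] using congrFun (congrFun (congrFun (congrFun (h t) x) y) a) b

/-! ## §3 Localised kernels: convergence of the image series, the entrywise tail, the entrywise limit -/

section Geometry

/-- [folklore] `(x + s·t) − p = (x − p) + s·t`. -/
theorem imageShift_sub (s : ℕ) (x t p : Site D) : imageShift s x t - p = imageShift s (x - p) t := by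
  funext i; simp [imageShift]; ring

/-- [folklore] `|a − b|₁ ≤ |a|₁ + |b|₁`. -/
theorem l1_sub_le (a b : Site D) : l1 (a - b) ≤ l1 a + l1 b := by
  simpa [sub_zero, zero_sub, l1_neg] using l1_sub_triangle a 0 b

/-- [folklore] THE IMAGES ARE FAR: `s·|t|₁ − |x − p|₁ ≤ |x + s·t − p|₁`. -/
theorem l1_imageShift_sub_ge (s : ℕ) (x t p : Site D) : (s : ℝ) * l1 t - l1 (x - p) ≤ l1 (imageShift s x t - p) := by
  have e : imageShift s x t - p - (x - p) = (s : ℤ) • t := by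
    funext i; simp only [Pi.sub_apply, imageShift_apply, Pi.smul_apply, smul_eq_mul]; ring
  have h := l1_sub_le (imageShift s x t - p) (x - p)
  rw [e, l1_natSmul] at h; linarith

/-- [folklore] … in exponential form (`0 ≤ δ`): `e^{−δ|x + s·t − p|₁} ≤ e^{δ|x − p|₁}·e^{−δs·|t|₁}`. -/
theorem exp_imageShift_sub_le {δ : ℝ} (hδ : 0 ≤ δ) (s : ℕ) (x t p : Site D) :
    Real.exp (-δ * l1 (imageShift s x t - p)) ≤ Real.exp (δ * l1 (x - p)) * Real.exp (-(δ * s) * l1 t) := by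
  rw [← Real.exp_add, Real.exp_le_exp]
  have h := mul_le_mul_of_nonneg_left (l1_imageShift_sub_ge s x t p) hδ
  nlinarith

/-- [folklore] The sum over ALL images of a decaying weight is at most the lattice constant: `Σ'_t e^{−c|x + s·t − p|₁} ≤ Zl D c` (`c > 0`, `s ≥ 1`;
the image map is injective). -/
theorem tsum_exp_imageShift_le {c : ℝ} (hc : 0 < c) (s : ℕ) [NeZero s] (x p : Site D) :
    (Summable fun t : Site D => Real.exp (-c * l1 (imageShift s x t - p))) ∧
      ∑' t : Site D, Real.exp (-c * l1 (imageShift s x t - p)) ≤ Zl D c := by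
  have hinj := imageShift_injective s (x - p)
  have hs : Summable fun t : Site D => Real.exp (-c * l1 (imageShift s (x - p) t)) := (summable_exp_neg_l1 hc D).comp_injective hinj
  simp only [imageShift_sub]
  exact ⟨hs, Summable.tsum_le_tsum_of_inj (imageShift s (x - p)) hinj (fun z _ => (Real.exp_pos _).le) (fun _ => le_rfl) hs
    (summable_exp_neg_l1 hc D)⟩

end Geometry

section Localised

variable {K : MKer D F} {p q : Site D} {C δ : ℝ}

/-- [folklore] Termwise bound of the image series of a bi-localised kernel by the `x`-side weight alone. -/
theorem abs_arr_term_le (hK : BiLoc K p q C δ) (hδ : 0 ≤ δ) (s : ℕ) (x y t : Site D) (a b : F) :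
    |K (imageShift s x t) (imageShift s y t) a b| ≤ C * Real.exp (-δ * l1 (imageShift s x t - p)) := by
  refine (hK _ _ a b).trans (mul_le_mul_of_nonneg_left ?_ (hK.nonneg a))
  exact Real.exp_le_exp.mpr (by nlinarith [l1_nonneg (imageShift s y t - q)])

/-- [folklore] **THE IMAGE SERIES CONVERGES ABSOLUTELY** for a bi-localised kernel (`δ > 0`, `s ≥ 1`). -/
theorem summable_abs_arr_term (hK : BiLoc K p q C δ) (hδ : 0 < δ) (s : ℕ) [NeZero s] (x y : Site D) (a b : F) :
    Summable fun t : Site D => |K (imageShift s x t) (imageShift s y t) a b| :=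
  Summable.of_nonneg_of_le (fun _ => abs_nonneg _) (fun t => abs_arr_term_le hK hδ.le s x y t a b)
    ((tsum_exp_imageShift_le hδ s x p).1.mul_left C)

/-- [folklore] … hence converges. -/
theorem summable_arr_term (hK : BiLoc K p q C δ) (hδ : 0 < δ) (s : ℕ) [NeZero s] (x y : Site D) (a b : F) :
    Summable fun t : Site D => K (imageShift s x t) (imageShift s y t) a b := (summable_abs_arr_term hK hδ s x y a b).of_abs

/-- [folklore] **THE ENTRYWISE TAIL**: `|arr s K x y a b − K x y a b| ≤ C·e^{δ|x − p|₁}·imageTail D (δ·s)` — every image but `t = 0` sits at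
`ℓ¹`-distance `≥ s|t|₁ − |x − p|₁` from the localisation point (`VolumeImages.imageTail D a = Σ_{t ≠ 0} e^{−a|t|₁}`). -/
theorem abs_arr_sub_le (hK : BiLoc K p q C δ) (hδ : 0 < δ) (s : ℕ) [NeZero s] (x y : Site D) (a b : F) :
    |arr s K x y a b - K x y a b| ≤ C * Real.exp (δ * l1 (x - p)) * imageTail D (δ * s) := by
  have hC : 0 ≤ C := hK.nonneg a
  set f : Site D → ℝ := fun t => K (imageShift s x t) (imageShift s y t) a b with hf
  have h0 : f 0 = K x y a b := by simp [hf]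
  have hsplit : arr s K x y a b - K x y a b = ∑' t : Site D, if t = 0 then 0 else f t := by
    rw [arr_apply, ← h0, (summable_arr_term hK hδ s x y a b).tsum_eq_add_tsum_ite 0]; ring
  rw [hsplit]
  have hmaj : ∀ t : Site D, ‖(if t = 0 then 0 else f t)‖ ≤
      C * Real.exp (δ * l1 (x - p)) * (if t = 0 then 0 else Real.exp (-(δ * s) * l1 t)) := fun t => by
    rw [Real.norm_eq_abs]
    split_ifs with ht
    · simp
    · calc |f t| ≤ C * Real.exp (-δ * l1 (imageShift s x t - p)) := abs_arr_term_le hK hδ.le s x y t a b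
        _ ≤ C * (Real.exp (δ * l1 (x - p)) * Real.exp (-(δ * s) * l1 t)) :=
            mul_le_mul_of_nonneg_left (exp_imageShift_sub_le hδ.le s x t p) hC
        _ = _ := by ring
  have hst : Summable fun t : Site D => C * Real.exp (δ * l1 (x - p)) * (if t = 0 then 0 else Real.exp (-(δ * s) * l1 t)) :=
    (summable_imageTail_term (mul_pos hδ (by exact_mod_cast Nat.pos_of_ne_zero (NeZero.ne s)))).mul_left _
  simpa only [Real.norm_eq_abs, tsum_mul_left, imageTail] using tsum_of_norm_bounded hst.hasSum hmaj

/-- [folklore] **THE ENTRYWISE LIMIT**: `arr s K x y a b → K x y a b` as `s → ∞` (`tendsto_imageTail_atTop`). -/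
theorem tendsto_arr (hK : BiLoc K p q C δ) (hδ : 0 < δ) (x y : Site D) (a b : F) :
    Tendsto (fun s : ℕ => arr s K x y a b) atTop (𝓝 (K x y a b)) := by
  have hmaj : Tendsto (fun s : ℕ => C * Real.exp (δ * l1 (x - p)) * imageTail D (δ * s)) atTop (𝓝 0) := by
    have h1 : Tendsto (fun s : ℕ => δ * (s : ℝ)) atTop atTop := Tendsto.const_mul_atTop hδ tendsto_natCast_atTop_atTop
    simpa using ((tendsto_imageTail_atTop D).comp h1).const_mul (C * Real.exp (δ * l1 (x - p)))
  have hev : ∀ᶠ s : ℕ in atTop, ‖arr s K x y a b - K x y a b‖ ≤ C * Real.exp (δ * l1 (x - p)) * imageTail D (δ * s) := by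
    filter_upwards [eventually_ge_atTop 1] with s hs
    haveI : NeZero s := ⟨by omega⟩
    simpa only [Real.norm_eq_abs] using abs_arr_sub_le hK hδ s x y a b
  exact tendsto_sub_nhds_zero_iff.mp (squeeze_zero_norm' hev hmaj)

end Localised

/-! ## §4 The `s`-uniform spread of the array of a localised kernel; tameness; row bounds of the fibres -/

section Spread

variable {K : MKer D F} {p q : Site D} {C δ : ℝ}

/-- [folklore] **THE ARRAY OF A BI-LOCALISED KERNEL IS SPREAD, UNIFORMLY IN `s ≥ 1`**:
`|arr s K x y a b| ≤ C·Zl D (δ∕2)·e^{(δ∕2)|p − q|₁} · e^{−(δ∕2)|x − y|₁}` (each image: `|x+st−p|₁ + |y+st−q|₁ ≥ |x − y|₁ − |p − q|₁`; half the rate localises,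
the other half sums the images). -/
theorem decays_arr (hK : BiLoc K p q C δ) (hδ : 0 < δ) (s : ℕ) [NeZero s] :
    Decays (arr s K) (C * Zl D (δ / 2) * Real.exp (δ / 2 * l1 (p - q))) (δ / 2) := by
  intro x y a b
  have hC : 0 ≤ C := hK.nonneg a
  obtain ⟨hsw, hle⟩ := tsum_exp_imageShift_le (half_pos hδ) s x p
  have hterm : ∀ t : Site D, |K (imageShift s x t) (imageShift s y t) a b| ≤
      C * Real.exp (δ / 2 * l1 (p - q)) * Real.exp (-(δ / 2) * l1 (x - y)) * Real.exp (-(δ / 2) * l1 (imageShift s x t - p)) := by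
    intro t
    refine (hK _ _ a b).trans ?_
    have hgeom : l1 (x - y) - l1 (p - q) ≤ l1 (imageShift s x t - p) + l1 (imageShift s y t - q) := by
      have h1 : l1 (x - y) ≤ l1 (x - y - (p - q)) + l1 (p - q) := by simpa only [sub_zero] using l1_sub_triangle (x - y) (p - q) 0
      have e : x - y - (p - q) = (imageShift s x t - p) - (imageShift s y t - q) := by funext i; simp [imageShift]; ring
      linarith [(e ▸ l1_sub_le (imageShift s x t - p) (imageShift s y t - q) : l1 (x - y - (p - q)) ≤ _)]
    have hexp : Real.exp (-δ * (l1 (imageShift s x t - p) + l1 (imageShift s y t - q))) ≤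
        Real.exp (δ / 2 * l1 (p - q)) * Real.exp (-(δ / 2) * l1 (x - y)) * Real.exp (-(δ / 2) * l1 (imageShift s x t - p)) := by
      rw [← Real.exp_add, ← Real.exp_add, Real.exp_le_exp]
      nlinarith [l1_nonneg (imageShift s y t - q), l1_nonneg (imageShift s x t - p)]
    calc C * Real.exp (-δ * (l1 (imageShift s x t - p) + l1 (imageShift s y t - q)))
        ≤ C * (Real.exp (δ / 2 * l1 (p - q)) * Real.exp (-(δ / 2) * l1 (x - y)) * Real.exp (-(δ / 2) * l1 (imageShift s x t - p))) :=
          mul_le_mul_of_nonneg_left hexp hC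
      _ = _ := by ring
  have hst : Summable fun t : Site D =>
      C * Real.exp (δ / 2 * l1 (p - q)) * Real.exp (-(δ / 2) * l1 (x - y)) * Real.exp (-(δ / 2) * l1 (imageShift s x t - p)) :=
    hsw.mul_left _
  have key := tsum_of_norm_bounded hst.hasSum (fun t => by rw [Real.norm_eq_abs]; exact hterm t)
  rw [Real.norm_eq_abs, tsum_mul_left] at key
  rw [arr_apply]
  refine key.trans ((mul_le_mul_of_nonneg_left hle (by positivity)).trans_eq (by ring))

/-- [folklore] … hence `Spr` (`TameKernelCalculus`), with the rate `δ∕2` for every `s ≥ 1`. -/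
theorem spr_arr (hK : BiLoc K p q C δ) (hδ : 0 < δ) (s : ℕ) [NeZero s] : Spr (arr s K) :=
  ⟨_, δ / 2, half_pos hδ, decays_arr hK hδ s⟩

/-- [folklore] … hence `Tame` (row∕column majorants, bounded: `comp_assoc_tame`, `tr_comp_comm_loc` apply). -/
theorem tame_arr [Fintype F] (hK : BiLoc K p q C δ) (hδ : 0 < δ) (s : ℕ) [NeZero s] : Tame (arr s K) :=
  (spr_arr hK hδ s).tame

/-- [folklore] … hence uniformly bounded entries: `|arr s K x y a b| ≤ C·Zl D (δ∕2)·e^{(δ∕2)|p−q|₁}`. -/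
theorem bdd_arr (hK : BiLoc K p q C δ) (hδ : 0 < δ) (s : ℕ) [NeZero s] :
    Bdd (arr s K) (C * Zl D (δ / 2) * Real.exp (δ / 2 * l1 (p - q))) :=
  bdd_of_decays (decays_arr hK hδ s) (half_pos hδ).le

/-- [folklore] … per fibre, in an4's vocabulary: `Decay₂` with the same `s`-free constant. -/
theorem decay₂_arr (hK : BiLoc K p q C δ) (hδ : 0 < δ) (s : ℕ) [NeZero s] (a b : F) :
    Decay₂ (Kfib (toF (arr s K)) a b) (C * Zl D (δ / 2) * Real.exp (δ / 2 * l1 (p - q))) (δ / 2) :=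
  fun x y => decays_arr hK hδ s x y a b

/-- [folklore] … hence every fibre has an `s`-UNIFORM `ℓ¹` ROW BOUND (the hypothesis `RowBound` of an4's `periodise₂_compKer` ∕ `lemma222_periodic` and of
leaf-03-g7's `periodiseF_compF` for the array as the RIGHT factor). -/
theorem rowBound_arr (hK : BiLoc K p q C δ) (hδ : 0 < δ) (s : ℕ) [NeZero s] (a b : F) :
    RowBound (Kfib (toF (arr s K)) a b)
      (C * Zl D (δ / 2) * Real.exp (δ / 2 * l1 (p - q)) * ∑' w : Site D, Real.exp (-(δ / 2) * l1 w)) :=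
  (decay₂_arr hK hδ s a b).rowBound (half_pos hδ)

/-- [folklore] … and absolutely summable rows (the hypothesis on the LEFT factor of `periodise₂_compKer` ∕ `periodiseF_compF`). -/
theorem summable_abs_row_arr (hK : BiLoc K p q C δ) (hδ : 0 < δ) (s : ℕ) [NeZero s] (a b : F) (x : Site D) :
    Summable fun y => |Kfib (toF (arr s K)) a b x y| :=
  (rowBound_arr hK hδ s a b).summable_abs x

end Spread

/-! ## §5 The periodisation of the array: independent images of both points; the diagonal unfolding (torus trace as one `ℤ^D` sum) -/

section Periodise

variable {K : MKer D F} {p q : Site D} {C δ : ℝ} {s : ℕ} [NeZero s]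

/-- [folklore] The DOUBLE image family `(t, n) ↦ K (x + s·t) (y + s·n) a b` of a bi-localised kernel is absolutely summable (product majorant
`C·e^{−δ|x+st−p|₁}·e^{−δ|y+sn−q|₁}`, each factor summing to `≤ Zl D δ`). -/
theorem summable_double_images (hK : BiLoc K p q C δ) (hδ : 0 < δ) (x y : Site D) (a b : F) :
    Summable fun tn : Site D × Site D => K (imageShift s x tn.1) (imageShift s y tn.2) a b := by
  have hC : 0 ≤ C := hK.nonneg a
  have hprod : Summable fun tn : Site D × Site D =>
      (C * Real.exp (-δ * l1 (imageShift s x tn.1 - p))) * Real.exp (-δ * l1 (imageShift s y tn.2 - q)) :=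
    Summable.mul_of_nonneg ((tsum_exp_imageShift_le hδ s x p).1.mul_left C) (tsum_exp_imageShift_le hδ s y q).1
      (fun _ => by positivity) (fun _ => (Real.exp_pos _).le)
  refine Summable.of_norm_bounded hprod fun tn => ?_
  rw [Real.norm_eq_abs]
  exact (hK _ _ a b).trans (le_of_eq (by rw [mul_add, Real.exp_add]; ring))

/-- [folklore] **THE PERIODISATION OF THE ARRAY IS THE DOUBLE IMAGE SUM**: `periodise₂ s (arr s K)ₐᵦ x̄ ȳ = Σ'_t Σ'_n K (x̂ + s·t) (ŷ + s·n) a b`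
(`x̂, ŷ` the window representatives; both points run over ALL their images independently — the torus kernel of the excitation `K`). -/
theorem periodise₂_arr (hK : BiLoc K p q C δ) (hδ : 0 < δ) (a b : F) (x y : Site D s) :
    periodise₂ s (Kfib (toF (arr s K)) a b) x y =
      ∑' t : Site D, ∑' n : Site D, K (imageShift s (windowMap D s x) t) (imageShift s (windowMap D s y) n) a b := by
  -- the double family is summable (`summable_double_images`); re-index `(n, t) ↦ (t, n + t)` on `ℤ^D × ℤ^D`
  let θ : Site D × Site D ≃ Site D × Site D :=
    ⟨fun nt => (nt.2, nt.1 + nt.2), fun tn => (tn.2 - tn.1, tn.1), fun nt => by simp, fun tn => by simp⟩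
  have hf : Summable (Function.uncurry fun n t : Site D =>
      K (imageShift s (windowMap D s x) t) (imageShift s (windowMap D s y) (n + t)) a b) :=
    (Equiv.summable_iff θ).mpr (summable_double_images (s := s) hK hδ (windowMap D s x) (windowMap D s y) a b)
  calc periodise₂ s (Kfib (toF (arr s K)) a b) x y
      = ∑' n : Site D, ∑' t : Site D, K (imageShift s (windowMap D s x) t) (imageShift s (windowMap D s y) (n + t)) a b := by
        simp only [periodise₂, Kfib_toF, arr_apply, imageShift_add]
    _ = ∑' t : Site D, ∑' n : Site D, K (imageShift s (windowMap D s x) t) (imageShift s (windowMap D s y) (n + t)) a b :=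
        hf.tsum_comm.symm
    _ = ∑' t : Site D, ∑' n : Site D, K (imageShift s (windowMap D s x) t) (imageShift s (windowMap D s y) n) a b :=
        tsum_congr fun t => (Equiv.addRight t).tsum_eq
          (fun n => K (imageShift s (windowMap D s x) t) (imageShift s (windowMap D s y) n) a b)

/-- [folklore] The diagonal-image function `x ↦ Σ'_m K x (x + s·m) a b` of a bi-localised kernel is absolutely summable over `ℤ^D`
(majorant `C·e^{−δ|x−p|₁}·Zl D δ`). -/
theorem summable_diagImages (hK : BiLoc K p q C δ) (hδ : 0 < δ) (a b : F) :
    (∀ x : Site D, Summable fun m : Site D => K x (imageShift s x m) a b) ∧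
      Summable fun x : Site D => ∑' m : Site D, K x (imageShift s x m) a b := by
  have hC : 0 ≤ C := hK.nonneg a
  have hterm : ∀ x m : Site D, ‖K x (imageShift s x m) a b‖ ≤ C * Real.exp (-δ * l1 (x - p)) * Real.exp (-δ * l1 (imageShift s x m - q)) :=
    fun x m => by rw [Real.norm_eq_abs]; exact (hK _ _ a b).trans (le_of_eq (by rw [mul_add, Real.exp_add]; ring))
  have hs1 : ∀ x : Site D, Summable fun m : Site D => C * Real.exp (-δ * l1 (x - p)) * Real.exp (-δ * l1 (imageShift s x m - q)) :=
    fun x => (tsum_exp_imageShift_le hδ s x q).1.mul_left _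
  refine ⟨fun x => Summable.of_norm_bounded (hs1 x) (hterm x), ?_⟩
  refine Summable.of_norm_bounded (((summable_exp_shift' hδ p).mul_left C).mul_right (Zl D δ)) fun x => ?_
  refine (tsum_of_norm_bounded (hs1 x).hasSum (hterm x)).trans ?_
  rw [tsum_mul_left]
  exact mul_le_mul_of_nonneg_left (tsum_exp_imageShift_le hδ s x q).2 (by positivity)

/-- [folklore] **THE DIAGONAL UNFOLDING** (TA3's starting line): the torus trace of the periodised array is ONE `ℤ^D` sum —
`Σ_{x̄ ∈ (ℤ∕s)^D} periodise₂ s (arr s K)ₐᵦ x̄ x̄ = Σ'_{x ∈ ℤ^D} Σ'_{m ∈ ℤ^D} K x (x + s·m) a b` (the window representative and its `t`-images together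
run over `ℤ^D` exactly once: `VolumeConvolution.tsum_eq_sum_tsum_imageShift`). -/
theorem sum_periodise₂_arr_diag (hK : BiLoc K p q C δ) (hδ : 0 < δ) (a b : F) :
    ∑ x : Site D s, periodise₂ s (Kfib (toF (arr s K)) a b) x x = ∑' x : Site D, ∑' m : Site D, K x (imageShift s x m) a b := by
  obtain ⟨hrowsum, hφ⟩ := summable_diagImages (s := s) hK hδ a b
  rw [tsum_eq_sum_tsum_imageShift (s := s) hφ]
  refine Finset.sum_congr rfl fun x _ => ?_
  rw [periodise₂_arr hK hδ a b x x]
  refine tsum_congr fun t => ?_  -- inner re-indexing `n = t + m`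
  rw [← (Equiv.addLeft t).tsum_eq (fun n => K (imageShift s (windowMap D s x) t) (imageShift s (windowMap D s x) n) a b)]
  exact tsum_congr fun m => by simp only [Equiv.coe_addLeft, imageShift_add]

end Periodise

/-! ## §6 Products: a periodic decaying leg passes through the array; two arrays compose to an array -/

section Products

variable [Fintype F] {A V X Y : MKer D F} {p q p' q' : Site D} {CA δA C δ C' δ' : ℝ} {s : ℕ} [NeZero s]

/-- [folklore] **A JOINTLY `s`-PERIODIC DECAYING LEG PASSES THROUGH THE ARRAY ON THE LEFT**: `comp A (arr s V) = arr s (comp A V)`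
(`A (x + s·t) (y + s·t) = A x y`, `Decays A`, `BiLoc V`; Fubini over `(y, t)` against the product majorant `e^{−δ_A|x−y|₁}·e^{−δ|z+st−q|₁}`, then the
re-indexing `y ↦ y + s·t` and the periodicity of `A`). -/
theorem comp_arr_right (hA : Decays A CA δA) (hδA : 0 < δA) (hAper : ∀ x y t, ∀ a b : F, A (imageShift s x t) (imageShift s y t) a b = A x y a b)
    (hV : BiLoc V p q C δ) (hδ : 0 < δ) : comp A (arr s V) = arr s (comp A V) := by
  funext x z a b
  have hCA : 0 ≤ CA := hA.nonneg a
  have hC : 0 ≤ C := hV.nonneg a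
  -- the summable family `(y, t) ↦ Σ_f A x y a f · V (y + s·t) (z + s·t) f b` and its product majorant
  have hmaj : ∀ y t : Site D, ‖∑ f, A x y a f * V (imageShift s y t) (imageShift s z t) f b‖ ≤
      ((Fintype.card F : ℝ) * CA * C) * Real.exp (-δA * l1 (x - y)) * Real.exp (-δ * l1 (imageShift s z t - q)) := by
    intro y t
    rw [Real.norm_eq_abs]
    calc |∑ f, A x y a f * V (imageShift s y t) (imageShift s z t) f b|
        ≤ ∑ f, |A x y a f * V (imageShift s y t) (imageShift s z t) f b| := Finset.abs_sum_le_sum_abs _ _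
      _ ≤ ∑ _f : F, CA * Real.exp (-δA * l1 (x - y)) * (C * Real.exp (-δ * l1 (imageShift s z t - q))) := by
          refine Finset.sum_le_sum fun f _ => ?_
          rw [abs_mul]
          refine mul_le_mul (hA _ _ a f) ?_ (abs_nonneg _) (by positivity)
          refine (hV _ _ f b).trans (mul_le_mul_of_nonneg_left ?_ hC)
          exact Real.exp_le_exp.mpr (by nlinarith [l1_nonneg (imageShift s y t - p)])
      _ = _ := by rw [Finset.sum_const, Finset.card_univ, nsmul_eq_mul]; ring
  have hsumG : Summable (Function.uncurry fun y t : Site D => ∑ f, A x y a f * V (imageShift s y t) (imageShift s z t) f b) :=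
    Summable.of_norm_bounded (Summable.mul_of_nonneg (((summable_exp_shift hδA x).mul_left ((Fintype.card F : ℝ) * CA * C)))
      (tsum_exp_imageShift_le hδ s z q).1 (fun _ => by positivity) (fun _ => (Real.exp_pos _).le)) (fun yt => hmaj yt.1 yt.2)
  calc comp A (arr s V) x z a b
      = ∑' y : Site D, ∑' t : Site D, ∑ f, A x y a f * V (imageShift s y t) (imageShift s z t) f b := by
        simp only [comp, arr_apply]
        refine tsum_congr fun y => ?_
        rw [Summable.tsum_finsetSum (fun f _ => (summable_arr_term hV hδ s y z f b).mul_left (A x y a f))]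
        exact Finset.sum_congr rfl fun f _ => tsum_mul_left.symm
    _ = ∑' t : Site D, ∑' y : Site D, ∑ f, A x y a f * V (imageShift s y t) (imageShift s z t) f b := hsumG.tsum_comm.symm
    _ = ∑' t : Site D, ∑' y : Site D, ∑ f, A (imageShift s x t) (imageShift s y t) a f * V (imageShift s y t) (imageShift s z t) f b := by
        simp only [hAper]
    _ = arr s (comp A V) x z a b := by
        simp only [arr_apply, comp, imageShift_eq_add_smul]
        exact tsum_congr fun t =>
          (Equiv.addRight ((s : ℤ) • t)).tsum_eq (fun y => ∑ f, A (x + (s : ℤ) • t) y a f * V y (z + (s : ℤ) • t) f b)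

/-- [folklore] **… AND ON THE RIGHT**: `comp (arr s V) A = arr s (comp V A)` (transpose the previous identity with `trK`). -/
theorem comp_arr_left (hA : Decays A CA δA) (hδA : 0 < δA) (hAper : ∀ x y t, ∀ a b : F, A (imageShift s x t) (imageShift s y t) a b = A x y a b)
    (hV : BiLoc V p q C δ) (hδ : 0 < δ) : comp (arr s V) A = arr s (comp V A) := by
  have h := comp_arr_right (s := s) (decays_trK hA) hδA (fun x y t a b => hAper y x t b a) (biLoc_trK hV) hδ
  -- `trK (comp (arr V) A) = comp (trK A) (trK (arr V)) = comp (trK A) (arr (trK V)) = arr (comp (trK A) (trK V)) = trK (arr (comp V A))`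
  have e : trK (comp (arr s V) A) = trK (arr s (comp V A)) := by
    rw [trK_comp, ← arr_trK, h, ← trK_comp, arr_trK]
  exact congrArg trK e

/-- [folklore] **TWO ARRAYS COMPOSE TO AN ARRAY**: `comp (arr s X) (arr s Y) = arr s (comp X (arr s Y))` for bi-localised `X`, `Y` (the right array is a
jointly periodic spread leg by §2∕§4). -/
theorem comp_arr_arr (hX : BiLoc X p q C δ) (hδ : 0 < δ) (hY : BiLoc Y p' q' C' δ') (hδ' : 0 < δ') :
    comp (arr s X) (arr s Y) = arr s (comp X (arr s Y)) :=
  comp_arr_left (decays_arr hY hδ' s) (half_pos hδ') (fun x y t a b => arr_imageShift s Y x y t a b) hX hδ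

end Products

end Summit.QuantumFields.BalabanUV.Beta.D1BFx.PeriodicArrays

end
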